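import Summits.QuantumFields.YangMills.Theorems.ConvexGribovBodyContinuumLegGivenGapStubExtract
import Summits.QuantumFields.YangMills.Theorems.ParabolicTrajectoryContinuumLimitOnTrajectoryDefsC

/-!
# Route `OneCertifiedCube`, crux `ContinuumLimitExists` (stmt-QuantumFields-16124), line `birth`: convergence is free — the ∃-stub without `ConvProducts`

Glue for the reshape v4 → v5 of the registered skeleton `Cruxes/ContinuumLimitExists/Lines/birth.lean`
(continuation lead `prover-line-stmt-QuantumFields-16124-c2-0`, cycle c2, 2026-08-17).

The v1–v4 constructive ∃-stub `stub_uvScheme` asked, for every compact simple `G`, for a weak-coupling,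
polynomially growing Wilson sequence `(r, sch)` with FULL-SEQUENCE CONVERGENCE of all canonical curvature
`p`-point functions on off-diagonal real product tensors (`ConvProducts r sch` — in the two-orbit architecture
the output of Bałaban's chart plus two-orbit synchronisation, `uvScheme345_of_twoOrbit`, p150943), uniform
plaquette-string bounds (`UUVB`) and the two non-degeneracy floors (`ND2`, `ND3`). Because the crux
`ContinuumLimitExists` is EXISTENTIAL in the scheme and every clause but `ConvProducts` is an
`∀ᶠ k in atTop` / `Tendsto … atTop` statement, the convergence clause is FREE: by the landed compactness
extraction of crux stmt-QuantumFields-15828 (`ContinuumLegGivenGap.exists_subseq_convProducts_of_uuvb`, file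
`…ConvexGribovBodyContinuumLegGivenGapStubExtract`: uniform-threshold bound `Transl.norm_curvDistribution_le_of_uuvb`
+ Cantor diagonal over a countable family dense in `⁰𝒮` for every finite family of Schwartz seminorms
(`separableSpace_schwartzMap_holds`) + `ε/3`), `UUVB r sch` alone yields a strictly increasing `ψ` with
`ConvProducts r (subScheme sch ψ hψ)`, and weak coupling, polynomial volume growth, `UUVB`, `ND2`, `ND3` ride
along the sub-scheme (`Literature.Barriers.QuantumFields.subScheme`; every canonical distribution of the
sub-scheme at step `k` is that of the scheme at step `ψ k`, definitionally). Hence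

* `exists_subScheme_convProducts` : weak → PVG → UUVB → ND2 → ND3 → ∃ ψ, all six clauses for `subScheme sch ψ hψ`;
* `uvScheme_of_uvBounds` : the v5 ∃-stub statement (`stub_uvBounds`: weak ∧ PVG ∧ UUVB ∧ ND2 ∧ ND3) implies the
  v4 ∃-stub statement (`stub_uvScheme`: … ∧ ConvProducts ∧ …) — the reshape loses nothing and removes the
  uniqueness / synchronisation content (chart, two-orbit synchronisation, finite-size input) from the crux's burden:
  what remains of the constructive leg is UV STABILITY WITH OBSERVABLES (`UUVB`) and NON-DEGENERACY (`ND2 ∧ ND3`)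
  along SOME weak-coupling Wilson sequence — the compactness route, which the barrier
  `Literature.Barriers.QuantumFields.UVStabilityNonUniqueness` does not obstruct for an existentially quantified
  sequential scheme (its audit 2026-08-16, `isYangMillsFor_subScheme_iff`).

Refs: `Cruxes/ContinuumLimitExists/{NOTES.md, CYCLE-c2.md, Lines/birth.lean}`; JaffeWitten2000 §6 (limits along a
sequence); Jaffe–Witten (Clay 2006) §6.5 fn. 2 ("weak existence (compactness)").
-/

set_option autoImplicit false

noncomputable section

namespace Summit.QuantumFields.YangMills.Cruxes.ContinuumLimitExists.Birth

open Filter Topology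
open Literature.MathematicalPhysics.QuantumFieldTheory
open Summit.QuantumFields.YangMills.Cruxes.ContinuumLimitOnTrajectory.TwoOrbitSynchronisation
open Literature.Barriers.QuantumFields (subScheme hasWeakCouplingLimit_subScheme)
open Summit.QuantumFields.YangMills.Theorems.ContinuumLegGivenGap (exists_subseq_convProducts_of_uuvb)

variable {G : Type} [Group G] [TopologicalSpace G] [IsTopologicalGroup G] [CompactSpace G]
  [MeasurableSpace G] [BorelSpace G]

/-- Polynomial volume growth rides along every sub-scheme (an `∀ᶠ k in atTop` clause read at the steps `φ k`). -/
theorem polyVolumeGrowth_subScheme {ι : Type} {sch : SpeciesScheme ι} (h : PolyVolumeGrowth sch)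
    (φ : ℕ → ℕ) (hφ : StrictMono φ) : PolyVolumeGrowth (subScheme sch φ hφ) := by
  obtain ⟨N, hN, hev⟩ := h
  exact ⟨N, hN, hφ.tendsto_atTop.eventually hev⟩

/-- The uniform-threshold plaquette-string bounds `UUVB` ride along every sub-scheme, with the same Schwartz index and
constants (the canonical distributions of the sub-scheme at step `k` are those of the scheme at step `φ k`). -/
theorem uuvb_subScheme {r : LatticeRep G} {sch : SpeciesScheme (YMSpecies G)} (h : UUVB r sch)
    (φ : ℕ → ℕ) (hφ : StrictMono φ) : UUVB r (subScheme sch φ hφ) := by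
  obtain ⟨s, α, β, hev⟩ := h
  exact ⟨s, α, β, hφ.tendsto_atTop.eventually hev⟩

/-- The two-point floor `ND2` rides along every sub-scheme, with the same test functions and the same `δ`. -/
theorem nd2_subScheme {r : LatticeRep G} {sch : SpeciesScheme (YMSpecies G)} (h : ND2 r sch)
    (φ : ℕ → ℕ) (hφ : StrictMono φ) : ND2 r (subScheme sch φ hφ) := by
  obtain ⟨F, G₁, H, hF, hG₁, hH, δ, hδ, hev⟩ := h
  exact ⟨F, G₁, H, hF, hG₁, hH, δ, hδ, hφ.tendsto_atTop.eventually hev⟩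

/-- The three-point floor `ND3` rides along every sub-scheme, with the same test functions and the same `δ`. -/
theorem nd3_subScheme {r : LatticeRep G} {sch : SpeciesScheme (YMSpecies G)} (h : ND3 r sch)
    (φ : ℕ → ℕ) (hφ : StrictMono φ) : ND3 r (subScheme sch φ hφ) := by
  obtain ⟨f, g, h₃, F₃, hT, hOD, δ, hδ, hev⟩ := h
  exact ⟨f, g, h₃, F₃, hT, hOD, δ, hδ, hφ.tendsto_atTop.eventually hev⟩

/-- **Convergence is free (compactness).** A weak-coupling, polynomially growing Wilson sequence with uniform
plaquette-string bounds and the two non-degeneracy floors has a SUB-SEQUENCE along which, in addition, every canonical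
curvature `p`-point function converges on every off-diagonal real product tensor (`ConvProducts`), all other clauses
being inherited: `exists_subseq_convProducts_of_uuvb` (crux stmt-QuantumFields-15828's landed Cantor-diagonal extraction
on `curvCLM` over `⁰𝒮`, from `UUVB` alone) with `S = univ`, plus the four transport lemmas above and
`hasWeakCouplingLimit_subScheme`. -/
theorem exists_subScheme_convProducts (r : LatticeRep G) (sch : SpeciesScheme (YMSpecies G))
    (hW : sch.HasWeakCouplingLimit) (hGr : PolyVolumeGrowth sch) (hU : UUVB r sch) (hND2 : ND2 r sch)
    (hND3 : ND3 r sch) :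
    ∃ (ψ : ℕ → ℕ) (hψ : StrictMono ψ),
      (subScheme sch ψ hψ).HasWeakCouplingLimit ∧ PolyVolumeGrowth (subScheme sch ψ hψ) ∧
        ConvProducts r (subScheme sch ψ hψ) ∧ UUVB r (subScheme sch ψ hψ) ∧
          ND2 r (subScheme sch ψ hψ) ∧ ND3 r (subScheme sch ψ hψ) := by
  obtain ⟨ψ, hψ, -, hconv⟩ := exists_subseq_convProducts_of_uuvb r sch hU Set.univ
    (Frequently.of_forall fun k => Set.mem_univ k)
  exact ⟨ψ, hψ, hasWeakCouplingLimit_subScheme hW ψ hψ, polyVolumeGrowth_subScheme hGr ψ hψ, hconv,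
    uuvb_subScheme hU ψ hψ, nd2_subScheme hND2 ψ hψ, nd3_subScheme hND3 ψ hψ⟩

/-- **The v4 ∃-stub from the v5 ∃-stub (the reshape loses nothing).** If for every compact simple `G` there is a
weak-coupling, polynomially growing Wilson sequence with `UUVB`, `ND2`, `ND3` (the statement of the v5 registered stub
`stub_uvBounds`), then for every compact simple `G` there is one with, moreover, full-sequence convergence on products
(the statement of the v1–v4 registered stub `stub_uvScheme`): take the sub-scheme of `exists_subScheme_convProducts`.
So `ConvProducts` — the uniqueness / synchronisation content of the two-orbit architecture (`ChartExists`,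
`TwoOrbitSync`, `QualFiniteSizeInput` in `uvScheme345_of_twoOrbit`) — is not part of the burden of the existential crux. -/
theorem uvScheme_of_uvBounds :
    (∀ (G : Type) [Group G] [TopologicalSpace G] [IsTopologicalGroup G] [CompactSpace G]
      [MeasurableSpace G] [BorelSpace G], IsCompactSimpleLieGroup G →
      ∃ (r : LatticeRep G) (sch : SpeciesScheme (YMSpecies G)),
        sch.HasWeakCouplingLimit ∧ PolyVolumeGrowth sch ∧ UUVB r sch ∧ ND2 r sch ∧ ND3 r sch) →
    ∀ (G : Type) [Group G] [TopologicalSpace G] [IsTopologicalGroup G] [CompactSpace G]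
      [MeasurableSpace G] [BorelSpace G], IsCompactSimpleLieGroup G →
      ∃ (r : LatticeRep G) (sch : SpeciesScheme (YMSpecies G)),
        sch.HasWeakCouplingLimit ∧ PolyVolumeGrowth sch ∧ ConvProducts r sch ∧ UUVB r sch ∧
          ND2 r sch ∧ ND3 r sch := by
  intro h G _ _ _ _ _ _ hG
  obtain ⟨r, sch, hW, hGr, hU, hND2, hND3⟩ := h G hG
  obtain ⟨ψ, hψ, h₁, h₂, h₃, h₄, h₅, h₆⟩ := exists_subScheme_convProducts r sch hW hGr hU hND2 hND3
  exact ⟨r, subScheme sch ψ hψ, h₁, h₂, h₃, h₄, h₅, h₆⟩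

end Summit.QuantumFields.YangMills.Cruxes.ContinuumLimitExists.Birth

end
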